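import Summits.QuantumAdvantage.QuantumAdvantage.Theorems.WbwObfuscatedGluedTreesKowPhPrograms
import Summits.QuantumAdvantage.QuantumAdvantage.Theorems.WbwObfuscatedGluedTreesKowPhWalkSemAux
import Summits.QuantumAdvantage.QuantumAdvantage.Theorems.WbwObfuscatedGluedTreesKowNbrSort

/-!
# `WbwObfuscatedGluedTrees` (stmt-QuantumAdvantage-2340) — line `knowledge-of-walk-split`, STAGE 7 (the PRF hybrid):
# the output map of the layer-C program is polynomial time on codes (registered stub `stub_walkFPOut`)

The output map `walkOut Λ (n, req) as` of the adaptive straight-line program of layer C (`KowPhPrograms` §5) — the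
answer to the walker's request after the layer-B answers `as` — is computed on the codes `⟨⟨1ⁿ, req⟩, as⟩`
(`pairE (pairE unE strE) (listE strE)`) by a polynomial-time string function, in the tree's `CodeFP` algebra, GIVEN
the two schedules `1ⁿ ↦ 1^{μ(n)}`, `1ⁿ ↦ 1^{d(n)}` on codes (hypotheses):

* §1 the `match` of `walkOut` on the request is a cascade of tests on its first two bits (`wo_walkOut_eq`; the
  ill-formed requests fall into the bit-query branch, where `|q| = 0 ≠ 2N`);
* §2 bricks over computed arguments: the head bit and the depth field `labDepth` of a string, the NUMBER of
  neighbour labels (`2` at a root, `3` otherwise — only the length of `nbrLabels` enters `walkOut`), the names read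
  off the answer list at the indices `4, …, 4 + #nbrs - 1` (`CodeFP.map` over `List.range`), their sorting by binary
  value (`sortByVal = insertionSort`, toolkit `toolkit_phWalkSemAux`, computed by toolkit `toolkit_sortNames`), and
  the answer string `fit (3N + 2) (⟨#R⟩₂ ++ flatten R)` read at position `val (q ⇂ N)` (adapted from the assembly of
  toolkit `toolkit_nbrBitFP`);
* §3 the bit-query branch and the assembly (`CodeFP.ite` on the first two request bits).

[folklore] (closure of polynomial time under composition, AroraBarak2009 §1.3; objects: ChildsEtAl2003 §2 and §4
Game 1 (the request oracle and its answer strings)).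
-/

set_option linter.dupNamespace false

noncomputable section

namespace Summit.QuantumAdvantage.QuantumAdvantage.Theorems.WbwObfuscatedGluedTrees.KnowledgeOfWalk.PrfHybrid

open Literature.Computability.Complexity Literature.Computability.QuantumComplexity
open Literature.Computability.QuantumComplexity.GluedTrees
open Literature.Computability.Cryptography Literature.Computability.Cryptography.ObfuscatedGluedTrees
open Summit.QuantumAdvantage.QuantumAdvantage.Theorems.WbwObfuscatedGluedTrees.KnowledgeOfWalk.BlackBox
open Summit.QuantumAdvantage.QuantumAdvantage.Theorems.WbwObfuscatedGluedTrees.KnowledgeOfWalk.RealIdeal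
open _root_.Computability
open Literature.Computability.Complexity.CodeFP (unE pairE strE listE natE bitE rawE fst snd const strTake strDrop
  strAppend strLength strVal natOfUn unSucc unAdd unMulConst natEq natMod natAdd natDiv ulength natLength rawOfList
  rawGetD strGetD strGetDNat strFlatten consBit urange unE_injective bitE_injective)
open Summit.QuantumAdvantage.QuantumAdvantage.Theorems.WbwObfuscatedGluedTrees.KnowledgeOfWalk.Generator
  (toolkit_sortNames)

/-! ## §1 The output map by tests -/

/-- **The output map by tests**: the `match` of `walkOut` on the walker's request is the cascade "first bit or
second bit set? (the EXIT / ENTRANCE name, answer `0`) else the bit-query branch at `q = req ⇂ 2`" (the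
fall-through requests `[]`, `[0]` land in the bit-query branch with `|q| = 0 ≠ 2N`); in the bit-query branch a
rejected name gets `[0]`, a recognised one the bit `val (q ⇂ N)` of the answer string assembled from the sorted
names answered at the indices `4, …`. [folklore] -/
private theorem wo_walkOut_eq (Λ : Params) (a : ℕ × List Bool) (as : List (List Bool)) :
    walkOut Λ a as =
      (if a.2.getD 0 false || a.2.getD 1 false then as.getD 0 []
      else if (a.2.drop 2).length =
          nameLen (Λ.prfParam a.1) (Λ.depth a.1) + nameLen (Λ.prfParam a.1) (Λ.depth a.1) then
        (if ((as.getD 0 []).headD false) = false then [false]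
        else
          [(fit (ansLen (nameLen (Λ.prfParam a.1) (Λ.depth a.1)))
            (bitsOf 2 (sortByVal ((List.range (nbrLabels (Λ.depth a.1) (as.getD 0 []).tail (as.getD 2 [])
                (as.getD 3 [])).length).map fun t => as.getD (4 + t) [])).length ++
              (sortByVal ((List.range (nbrLabels (Λ.depth a.1) (as.getD 0 []).tail (as.getD 2 [])
                (as.getD 3 [])).length).map fun t => as.getD (4 + t) [])).flatten)).getD
            (bitsToNat ((a.2.drop 2).drop (nameLen (Λ.prfParam a.1) (Λ.depth a.1)))) false])
      else []) := by
  obtain ⟨n, req⟩ := a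
  have hN : ¬ (([] : List Bool).length =
      nameLen (Λ.prfParam n) (Λ.depth n) + nameLen (Λ.prfParam n) (Λ.depth n)) := by
    simp only [List.length_nil, nameLen, labelLen]; omega
  rcases req with _ | ⟨_ | _, _ | ⟨_ | _, q⟩⟩ <;>
    simp only [walkOut, List.getD_nil, List.getD_cons_zero, List.getD_cons_succ, Bool.false_or, Bool.true_or,
      Bool.false_eq_true, if_false, if_true, List.drop_succ_cons, List.drop_zero, List.drop_nil, if_neg hN]

/-! ## §2 Bricks: the head bit, the depth field, the number of neighbours, the names and the answer bit -/

section Bricks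

variable {α : Type} {eα : α → List Bool}

/-- The head bit of a computed string (`false` if empty) (adapted from the sibling `KowPhWalkFPQ`). [folklore] -/
private theorem wo_headD {fx : α → List Bool} (hx : CodeFP eα strE fx) :
    CodeFP eα bitE (fun a => (fx a).headD false) :=
  (strGetD.comp ((const eα 0).pair hx)).congr fun a => by cases fx a <;> rfl

/-- The depth field `labDepth d x` of a computed string, as a numeral (adapted from the sibling `KowPhWalkFPQ`).
[folklore] -/
private theorem wo_labDepth {fd : α → ℕ} {fx : α → List Bool} (hd : CodeFP eα unE fd)
    (hx : CodeFP eα strE fx) : CodeFP eα natE (fun a => labDepth (fd a) (fx a)) :=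
  (strVal.comp (strTake.comp ((unSucc.comp hd).pair (strDrop.comp ((const eα 1).pair hx))))).congr fun _ => rfl

/-- **Only the number of neighbour labels enters the output map**: `nbrLabels d x p₂ p₃` lists `2` labels when the
depth field of `x` is `0` (a root: two children) and `3` otherwise (parent and two children, or parent and two
cross leaves). [cite: ChildsEtAl2003, §2] -/
private theorem wo_length_nbrLabels (d : ℕ) (x p₂ p₃ : List Bool) :
    (nbrLabels d x p₂ p₃).length = if labDepth d x = 0 then 2 else 3 := by
  simp only [nbrLabels, List.length_append]
  split_ifs <;> rfl

/-- The number of neighbour labels of computed `d`, `x`, `p₂`, `p₃`, in unary (a test on the depth field).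
[cite: AroraBarak2009, §1.3] -/
private theorem wo_nbrCount {fd : α → ℕ} {fx f₂ f₃ : α → List Bool} (hd : CodeFP eα unE fd)
    (hx : CodeFP eα strE fx) :
    CodeFP eα unE (fun a => (nbrLabels (fd a) (fx a) (f₂ a) (f₃ a)).length) :=
  ((natEq.comp ((wo_labDepth hd hx).pair (const eα (0 : ℕ)))).ite (const eα (2 : ℕ)) (const eα (3 : ℕ))).congr
    fun a => by rw [wo_length_nbrLabels]; by_cases h : labDepth (fd a) (fx a) = 0 <;> simp [h]

/-- **The names read off the answer list**: `(List.range k).map (t ↦ as[4 + t] or [])` of a computed raw list `as`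
and a computed unary count `k` (`CodeFP.map` with the list as context over `List.range k`). [cite: AroraBarak2009, §1.3] -/
private theorem wo_names {fas : α → List (List Bool)} {fk : α → ℕ} (has : CodeFP eα (rawE strE) fas)
    (hk : CodeFP eα unE fk) :
    CodeFP eα (rawE strE) (fun a => (List.range (fk a)).map fun t => (fas a).getD (4 + t) []) := by
  have hg : CodeFP (pairE (rawE strE) natE) strE (fun p : List (List Bool) × ℕ => p.1.getD (4 + p.2) []) :=
    (rawGetD strE rfl).comp ((fst _ _).pair (natAdd.comp ((const _ (4 : ℕ)).pair (snd _ _))))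
  exact ((CodeFP.map hg).comp (has.pair (urange.comp hk))).congr fun _ => rfl

/-- Sorting computed names by binary value: `sortByVal` is the insertion sort of toolkit `toolkit_phWalkSemAux`,
computed on codes by toolkit `toolkit_sortNames`. [folklore] -/
private theorem wo_sortByVal {fL : α → List (List Bool)} (hL : CodeFP eα (rawE strE) fL) :
    CodeFP eα (rawE strE) (fun a => sortByVal (fL a)) :=
  (toolkit_sortNames.comp hL).congr fun _ => (toolkit_phWalkSemAux _).symm

/-- The two low-order bits of `n` are its parity and the parity of `n / 2` (adapted from toolkit `NbrBitFP`).
[folklore] -/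
private theorem wo_bitsOf_two (n : ℕ) : bitsOf 2 n = [decide (n % 2 = 1), decide (n / 2 % 2 = 1)] := by
  simp [bitsOf, List.ofFn_succ, Nat.testBit_succ]

/-- **The answer bit on codes** (adapted from the assembly of toolkit `toolkit_nbrBitFP`): from ANY map `R`
computed on codes into raw lists of strings, a computed unary `N` and a computed string `q`, the one-bit string
`[(fit (3N + 2) (bitsOf 2 |R| ++ flatten R))[val (q ⇂ N)]]` is computed on codes (`CodeFP.natLength`, two parity
bits by `natMod` / `natDiv` / `natEq`, `CodeFP.strFlatten`, `FPData.fitFP`, `CodeFP.strVal`, `CodeFP.strGetDNat`).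
[folklore] -/
private theorem wo_answerBit {fN : α → ℕ} {fq : α → List Bool} {fR : α → List (List Bool)}
    (hN : CodeFP eα unE fN) (hq : CodeFP eα strE fq) (hR : CodeFP eα (rawE strE) fR) :
    CodeFP eα strE (fun a =>
      [(fit (ansLen (fN a)) (bitsOf 2 (fR a).length ++ (fR a).flatten)).getD
        (bitsToNat ((fq a).drop (fN a))) false]) := by
  have hAnsLen : CodeFP eα unE (fun a => ansLen (fN a)) :=
    (unAdd.comp (((unMulConst 3).comp hN).pair (const eα (2 : ℕ)))).congr fun _ => rfl
  have hlen : CodeFP eα natE (fun a => (fR a).length) := (natLength strE).comp hR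
  have hb0 : CodeFP eα bitE (fun a => decide ((fR a).length % 2 = 1)) :=
    natEq.comp ((natMod.comp (hlen.pair (const eα (2 : ℕ)))).pair (const eα (1 : ℕ)))
  have hb1 : CodeFP eα bitE (fun a => decide ((fR a).length / 2 % 2 = 1)) :=
    natEq.comp ((natMod.comp ((natDiv.comp (hlen.pair (const eα (2 : ℕ)))).pair (const eα (2 : ℕ)))).pair
      (const eα (1 : ℕ)))
  have hbits : CodeFP eα strE (fun a => bitsOf 2 (fR a).length) :=
    (consBit.comp (hb0.pair (consBit.comp (hb1.pair (const eα ([] : List Bool)))))).congr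
      fun _ => (wo_bitsOf_two _).symm
  have hAns : CodeFP eα strE (fun a => fit (ansLen (fN a)) (bitsOf 2 (fR a).length ++ (fR a).flatten)) :=
    FPData.fitFP.comp (hAnsLen.pair (strAppend.comp (hbits.pair (strFlatten.comp hR))))
  have hIdx : CodeFP eα natE (fun a => bitsToNat ((fq a).drop (fN a))) :=
    strVal.comp (strDrop.comp (hN.pair hq))
  exact (strGetDNat.comp (hAns.pair hIdx)).recodeOut fun _ => rfl

end Bricks

/-! ## §3 The bit-query branch and the assembly -/

section Assembly

variable {α : Type} {eα : α → List Bool}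

/-- **The bit-query branch on codes** (`req = 0 0 q`): from computed `μ`, `d`, `q` and the raw answer list `as`,
the answer — `[]` unless `|q| = 2N`; `[0]` for a rejected name (recognition bit `0` of answer `0`); otherwise the
bit `val (q ⇂ N)` of the answer string of the sorted names answered at the indices `4, …, 4 + #nbrs - 1`. Every
test is a computed bit and the branch a cascade of `CodeFP.ite`. [cite: AroraBarak2009, §1.3] -/
private theorem wo_outC {fμ fd : α → ℕ} {fq : α → List Bool} {fas : α → List (List Bool)}
    (hμ : CodeFP eα unE fμ) (hd : CodeFP eα unE fd) (hq : CodeFP eα strE fq) (has : CodeFP eα (rawE strE) fas) :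
    CodeFP eα strE (fun a =>
      if (fq a).length = nameLen (fμ a) (fd a) + nameLen (fμ a) (fd a) then
        (if (((fas a).getD 0 []).headD false) = false then [false]
        else
          [(fit (ansLen (nameLen (fμ a) (fd a)))
            (bitsOf 2 (sortByVal ((List.range (nbrLabels (fd a) ((fas a).getD 0 []).tail ((fas a).getD 2 [])
                ((fas a).getD 3 [])).length).map fun t => (fas a).getD (4 + t) [])).length ++
              (sortByVal ((List.range (nbrLabels (fd a) ((fas a).getD 0 []).tail ((fas a).getD 2 [])
                ((fas a).getD 3 [])).length).map fun t => (fas a).getD (4 + t) [])).flatten)).getD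
            (bitsToNat ((fq a).drop (nameLen (fμ a) (fd a)))) false])
      else []) := by
  have hN : CodeFP eα unE (fun a => nameLen (fμ a) (fd a)) :=
    (unAdd.comp (hμ.pair (unSucc.comp (unSucc.comp (unSucc.comp ((unMulConst 2).comp hd)))))).congr fun _ => rfl
  have hg : ∀ k : ℕ, CodeFP eα strE (fun a => (fas a).getD k []) := fun k =>
    (rawGetD strE rfl).comp (has.pair (const eα k))
  have hx : CodeFP eα strE (fun a => ((fas a).getD 0 []).tail) :=
    (strDrop.comp ((const eα 1).pair (hg 0))).congr fun _ => List.drop_one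
  have hR := wo_sortByVal (wo_names has (wo_nbrCount (f₂ := fun a => (fas a).getD 2 [])
    (f₃ := fun a => (fas a).getD 3 []) hd hx))
  have hbit := wo_answerBit hN hq hR
  -- the tests
  have tq : CodeFP eα bitE (fun a => decide ((fq a).length = nameLen (fμ a) (fd a) + nameLen (fμ a) (fd a))) :=
    (CodeFP.eq unE_injective).comp ((strLength.comp hq).pair (unAdd.comp (hN.pair hN)))
  have th : CodeFP eα bitE (fun a => decide (((fas a).getD 0 []).headD false = false)) :=
    (CodeFP.eq bitE_injective).comp ((wo_headD (hg 0)).pair (const eα false))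
  refine ((tq.ite (th.ite (const eα [false]) hbit)) (const eα ([] : List Bool))).congr fun a => ?_
  simp only [decide_eq_true_eq]

end Assembly

/-! ## The registered stub -/

/-- **Stub (layer C, the output map is polynomial time)**: the output map `walkOut Λ` of the layer-C program is
computed on the codes `⟨⟨1ⁿ, req⟩, as⟩` by a polynomial-time string function (`CodeFP`), given the two schedules
`1ⁿ ↦ 1^{μ(n)}`, `1ⁿ ↦ 1^{d(n)}` on codes: every ingredient — the name length `N = μ + 2d + 3`, the depth field of
the recognised label (hence the number `2` or `3` of neighbours), the names read off the answer list at the indices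
`4, …` (`CodeFP.map` over `List.range`), their insertion sort by binary value (toolkit `toolkit_sortNames`), the
answer string `fit (3N + 2) (⟨#R⟩₂ ++ flatten R)` and its bit at `val (q ⇂ N)` — is a typed combinator of the
tree's `CodeFP` algebra, and the `match` on the request is a cascade of `CodeFP.ite` on its first two bits
(`wo_walkOut_eq`). [cite: AroraBarak2009, §1.3 (closure of polynomial time under composition)] -/
theorem stub_walkFPOut :
    ∀ (Λ : Params), CodeFP unE unE Λ.prfParam → CodeFP unE unE Λ.depth →
      CodeFP (pairE (pairE unE strE) (listE strE)) strE
        (fun p : (ℕ × List Bool) × List (List Bool) => walkOut Λ p.1 p.2) := by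
  intro Λ hμΛ hdΛ
  have pn : CodeFP (pairE (pairE unE strE) (listE strE)) unE (fun p => p.1.1) := (fst _ _).fst'
  have pr : CodeFP (pairE (pairE unE strE) (listE strE)) strE (fun p => p.1.2) := (fst _ _).snd'
  have pas : CodeFP (pairE (pairE unE strE) (listE strE)) (rawE strE) (fun p => p.2) :=
    (rawOfList strE).comp (snd _ _)
  have hμ : CodeFP (pairE (pairE unE strE) (listE strE)) unE (fun p => Λ.prfParam p.1.1) := hμΛ.comp pn
  have hd : CodeFP (pairE (pairE unE strE) (listE strE)) unE (fun p => Λ.depth p.1.1) := hdΛ.comp pn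
  have hb₀ : CodeFP (pairE (pairE unE strE) (listE strE)) bitE (fun p => p.1.2.getD 0 false) :=
    strGetD.comp ((const _ 0).pair pr)
  have hb₁ : CodeFP (pairE (pairE unE strE) (listE strE)) bitE (fun p => p.1.2.getD 1 false) :=
    strGetD.comp ((const _ 1).pair pr)
  -- the EXIT / ENTRANCE branch: the name answered to request `0`
  have hAB : CodeFP (pairE (pairE unE strE) (listE strE)) strE (fun p => p.2.getD 0 []) :=
    (rawGetD strE rfl).comp (pas.pair (const _ (0 : ℕ)))
  have hC := wo_outC hμ hd (strDrop.comp ((const _ 2).pair pr)) pas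
  exact ((hb₀.or hb₁).ite hAB hC).congr fun p => by rw [wo_walkOut_eq]

end Summit.QuantumAdvantage.QuantumAdvantage.Theorems.WbwObfuscatedGluedTrees.KnowledgeOfWalk.PrfHybrid

end
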